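import Literature.Analysis.FluidPDE.CheskidovPeriodisation
import Literature.Analysis.FunctionSpaces.TorusLerayHelmholtzSpaceTime
import HarnessLib

/-!
# Cheskidov's periodisation for partial-dissipation families

Analysis/FluidPDE file (all proved; no named facts). The §6 periodisation argument of Cheskidov,
arXiv:2311.04182 (2023) — carried out for the *total*-dissipation family
(`Literature.Analysis.FluidPDE.cheskidov_total_dissipation_family`, hypothesis structure
`CheskidovPeriodic.FamilyData`) in `CheskidovPeriodisedFamily`, `CheskidovForceIdentities`,
`CheskidovLimitForce`, `CheskidovHelmholtzForces`, `CheskidovPeriodisation` — uses the totality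
of the dissipation, `‖θ̃^m(1)‖_{L²} → 0`, at exactly one place: to identify the limit of the
scalar forces `h^m = η' θ̃^m` on the ramp-down window `(5/4, 13/10)` (there `h^m → 0`). If
instead the scalars converge strongly after the mixing time, `sup_{t ∈ [1,2]} ‖θ̃^m(t) - R‖_{L²} → 0`
for a fixed `R ∈ L²(T²)`, the same argument gives `h^m → η' R` there, still in `L^∞(ℝ; L²)`, and
Theorem 1.3 follows verbatim provided the dissipated fraction `2ν_m∫ₛ¹‖∇θ̃^m‖² → ε₀` stays above
`1/2` (any positive bound would do after changing two constants). This file records that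
generalisation: the hypothesis structure `CheskidovPeriodic.PartialFamilyData`
(`FamilyData.toPartial` embeds the total case), and, for `D : PartialFamilyData`, the whole
chain of the five files above with identical statements and proofs except

* `PartialFamilyData.Hw = χ • ρ̃ + χ_late • R` (`chiLate = η' · stepUp`, `= η'` for `t ≥ 1`,
  `= 0` for `t ≤ 1`), which is no longer smooth in space but still in `C(ℝ; L²)`
  (`Hw_continuousInLpOn`, `Hinf_continuousInLpOn`, `Hinf_aestronglyMeasurable`);
* `eLpNorm_scalar_diff_le_late`: `‖η'(s)θ^m(s) - Hw(s)‖_{L²} ≤ M sup_{[1,2]} ‖θ^m - R‖_{L²}` for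
  `s ∈ [1, 2]`, fed by the clause `θ_late`;
* `eventually_meanDissipation_ge`: threshold `1/2 < ε₀` instead of `1/2 < 1`.

Main results: `PartialFamilyData.cheskidov_time_periodic_anomaly` and
`cheskidov_time_periodic_anomaly_of_partialFamilyData` (using the discharged smooth
Leray–Helmholtz decomposition `Torus.smooth_leray_helmholtz_holds`). Consumer: the
alternating-shear discharge of `Literature.Analysis.FluidPDE.cheskidov_time_periodic_anomaly`
(`ShearCascade*`), whose family dissipates only a fixed fraction `ε₀ ≥ 3/4` of the variance.

## References

* A. Cheskidov, arXiv:2311.04182 (2023), Thm. 1.3 (p. 5), §6 (pp. 18–19), (6.2)–(6.7).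
-/

open MeasureTheory Set Filter Topology Function
open scoped ENNReal InnerProductSpace
open Literature.Analysis.FunctionSpaces (timePeriodize timeWrap timePeriodize_apply)
open Literature.Analysis.FunctionSpaces.Torus (twoHalf planarProj)

noncomputable section

namespace Literature.Analysis.FluidPDE

namespace CheskidovPeriodic

/-- The flat three-torus (local notation). [folklore] -/
local notation "𝕋³" => UnitAddTorus (Fin 3)
/-- The flat two-torus (local notation). [folklore] -/
local notation "𝕋²" => UnitAddTorus (Fin 2)
/-- `ℝ³` (local notation). [folklore] -/
local notation "E³" => EuclideanSpace ℝ (Fin 3)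
/-- `ℝ²` (local notation). [folklore] -/
local notation "E²" => EuclideanSpace ℝ (Fin 2)

/-! ## The late cutoff `χ_late = η' · stepUp` -/

/-- The smooth step up `stepUp t = smoothTransition (10 (t - 1))`: `0` for `t ≤ 1`, `1` for
`t ≥ 11/10`. [folklore] -/
def stepUp (t : ℝ) : ℝ := Real.smoothTransition (10 * (t - 1))

/-- `stepUp` is smooth. [folklore] -/
theorem contDiff_stepUp {n : ℕ∞} : ContDiff ℝ n stepUp :=
  Real.smoothTransition.contDiff.comp (contDiff_const.mul (contDiff_id.sub contDiff_const))

/-- `stepUp t = 0` for `t ≤ 1`. [folklore] -/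
theorem stepUp_of_le {t : ℝ} (ht : t ≤ 1) : stepUp t = 0 :=
  Real.smoothTransition.zero_of_nonpos (by linarith)

/-- `stepUp t = 1` for `t ≥ 11/10`. [folklore] -/
theorem stepUp_of_ge {t : ℝ} (ht : 11 / 10 ≤ t) : stepUp t = 1 :=
  Real.smoothTransition.one_of_one_le (by linarith)

/-- **The late truncated derivative `χ_late = η' · stepUp`**: the time profile of the extra limit
scalar force `η' R` on the ramp-down window (`= η'` for `t ≥ 1`, `= 0` for `t ≤ 1`). [folklore] -/
def chiLate (t : ℝ) : ℝ := deriv eta t * stepUp t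

/-- `χ_late` is continuous. [folklore] -/
theorem continuous_chiLate : Continuous chiLate :=
  ((contDiff_eta (n := 1)).continuous_deriv le_rfl).mul (contDiff_stepUp (n := 0)).continuous

/-- `χ_late t = η' t` for `t ≥ 1` (`η' = 0` on `[3/4, 5/4]`, `stepUp = 1` from `11/10`). [folklore] -/
theorem chiLate_eq_deriv_eta {t : ℝ} (ht : 1 ≤ t) : chiLate t = deriv eta t := by
  rcases le_or_gt (11 / 10 : ℝ) t with h | h
  · rw [chiLate, stepUp_of_ge h, mul_one]
  · rw [chiLate, deriv_eta_eq_zero (Or.inl ⟨by linarith, by linarith⟩), zero_mul]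

/-- `χ_late t = 0` for `t ≤ 1`. [folklore] -/
theorem chiLate_eq_zero_of_le {t : ℝ} (ht : t ≤ 1) : chiLate t = 0 := by
  rw [chiLate, stepUp_of_le ht, mul_zero]

/-- `χ_late t = 0` for `t ∉ (7/10, 13/10)` (there `η' = 0`). [folklore] -/
theorem chiLate_eq_zero_of_not_mem {t : ℝ} (ht : t ∉ Ioo (7 / 10 : ℝ) (13 / 10)) : chiLate t = 0 := by
  rw [chiLate, deriv_eta_eq_zero (Or.inr ht), zero_mul]

/-! ## The data of a partial-dissipation family as a hypothesis structure -/

/-- **A partial-dissipation family** — the hypothesis structure `FamilyData` of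
`CheskidovPeriodisedFamily` (the clauses of `cheskidov_total_dissipation_family`: viscosities
`ν_m → 0`, drifts `v^m`, datum `ρ_in`, advection–diffusion solutions `θ^m` on `[0,2]`, inviscid
profile `ρ̃`, limit force `g`) with the *total* dissipation anomaly (6.4) (`‖θ^m(1)‖ → 0`,
`2ν_m∫ₛ¹‖∇θ^m‖² → 1`) weakened to a *partial* one: after the mixing time the scalars converge
strongly, uniformly on `[1, 2]`, to a fixed `R ∈ L²(T²)`, and `2ν_m∫ₛ¹‖∇θ^m‖² → ε₀` for some
`ε₀ > 1/2`. The periodisation argument of Cheskidov 2023, §6 goes through verbatim for such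
families (this file), the limit scalar force acquiring the extra term `η'(t) R` on the ramp-down
window; `FamilyData.toPartial` embeds the total-dissipation case (`R = 0`, `ε₀ = 1`). [cite: Cheskidov2023, §6 (6.2)–(6.7) and pp. 18–19] -/
structure PartialFamilyData where
  /-- viscosities `ν_m` -/
  ν : ℕ → ℝ
  /-- the planar drifts `v^m` -/
  v : ℕ → ℝ → 𝕋² → E²
  /-- the datum `ρ_in` -/
  ρin : 𝕋² → ℝ
  /-- the advection–diffusion solutions `θ^m` (`θ̃^m` in §6) -/
  θ : ℕ → ℝ → 𝕋² → ℝ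
  /-- the inviscid profile `ρ̃` -/
  ρ : ℝ → 𝕋² → ℝ
  /-- the limit Navier–Stokes force `g` of the drifts -/
  g : ℝ → 𝕋² → E²
  /-- the uniform `L²` bound of the drifts -/
  B : ℝ
  /-- the strong `L²` limit `R` of the scalars after the mixing time -/
  R : 𝕋² → ℝ
  /-- the limiting dissipated energy `ε₀ = 1 - ‖R‖²` -/
  ε₀ : ℝ
  ν_pos : ∀ m, 0 < ν m
  ν_tendsto : Tendsto ν atTop (𝓝 0)
  v_smooth : ∀ m, FunctionSpaces.Torus.IsSmoothSpaceTimeOn univ (v m)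
  v_divFree : ∀ m t, FunctionSpaces.Torus.IsDivFree (v m t)
  v_zeroMean : ∀ m t, FunctionSpaces.Torus.HasZeroMean (v m t)
  v_eq_zero : ∀ m, ∀ t ∉ Ioo (0 : ℝ) 1, v m t = 0
  v_sq_le : ∀ m t, ∫ x, ‖v m t x‖ ^ 2 ≤ B
  v_stationary : ∀ T < (1 : ℝ), ∃ m₁ : ℕ, ∀ m ≥ m₁, ∀ t ≤ T, v m t = v m₁ t
  ρin_smooth : FunctionSpaces.Torus.IsSmooth ρin
  ρin_zeroMean : FunctionSpaces.Torus.HasZeroMean ρin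
  ρin_sq : ∫ x, ρin x ^ 2 = 1
  θ_transport : ∀ m, Torus.IsClassicalScalarTransportOn (Icc 0 2) (ν m) (v m) (θ m)
  θ_zero : ∀ m, θ m 0 = ρin
  θ_zeroMean : ∀ m, ∀ t ∈ Icc (0 : ℝ) 2, FunctionSpaces.Torus.HasZeroMean (θ m t)
  θ_antitone : ∀ m, AntitoneOn (fun t => ∫ x, θ m t x ^ 2) (Icc (0 : ℝ) 2)
  R_memLp : MemLp R 2 volume
  θ_late : Tendsto (fun m => ⨆ t ∈ Icc (1 : ℝ) 2, eLpNorm (θ m t - R) 2 volume) atTop (𝓝 0)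
  half_lt_ε₀ : 2⁻¹ < ε₀
  θ_dissipation : ∀ s ∈ Ico (0 : ℝ) 1,
    Tendsto (fun m => 2 * ν m * ∫ t in s..1, Torus.scalarGradNormSq (θ m t)) atTop (𝓝 ε₀)
  ρ_smooth : FunctionSpaces.Torus.IsSmoothSpaceTimeOn (Ico 0 1) ρ
  θ_sub_ρ : ∀ T ∈ Ico (0 : ℝ) 1,
    Tendsto (fun m => ⨆ t ∈ Icc (0 : ℝ) T, eLpNorm (θ m t - ρ t) 2 volume) atTop (𝓝 0)
  g_smooth : ∀ t, FunctionSpaces.Torus.IsSmooth (g t)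
  g_cont : Torus.ContinuousInLpOn univ 2 g
  g_limit : Tendsto (fun m => ⨆ t : ℝ, eLpNorm (Torus.nsBodyForce (ν m) (v m) t - g t) 2 volume)
    atTop (𝓝 0)

/-- **The total-dissipation family is a partial-dissipation family** (`R = 0`, `ε₀ = 1`:
`sup_{t ∈ [1,2]} ‖θ^m(t)‖_{L²} ≤ ‖θ^m(1)‖_{L²} → 0` by the energy inequality). [cite: Cheskidov2023, (6.4)] -/
def FamilyData.toPartial (D : FamilyData) : PartialFamilyData where
  ν := D.ν
  v := D.v
  ρin := D.ρin
  θ := D.θ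
  ρ := D.ρ
  g := D.g
  B := D.B
  R := 0
  ε₀ := 1
  ν_pos := D.ν_pos
  ν_tendsto := D.ν_tendsto
  v_smooth := D.v_smooth
  v_divFree := D.v_divFree
  v_zeroMean := D.v_zeroMean
  v_eq_zero := D.v_eq_zero
  v_sq_le := D.v_sq_le
  v_stationary := D.v_stationary
  ρin_smooth := D.ρin_smooth
  ρin_zeroMean := D.ρin_zeroMean
  ρin_sq := D.ρin_sq
  θ_transport := D.θ_transport
  θ_zero := D.θ_zero
  θ_zeroMean := D.θ_zeroMean
  θ_antitone := D.θ_antitone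
  R_memLp := by simp
  θ_late := by
    have h1 : Tendsto (fun m => ENNReal.ofReal (Real.sqrt (∫ y, D.θ m 1 y ^ 2))) atTop (𝓝 0) := by
      have h := (Real.continuous_sqrt.tendsto 0).comp D.θ_one
      rw [Function.comp_def, Real.sqrt_zero] at h
      have := (ENNReal.continuous_ofReal.tendsto 0).comp h
      rwa [Function.comp_def, ENNReal.ofReal_zero] at this
    refine tendsto_of_tendsto_of_tendsto_of_le_of_le' tendsto_const_nhds h1
      (Eventually.of_forall fun m => zero_le) (Eventually.of_forall fun m => iSup₂_le fun t ht => ?_)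
    have hθt : FunctionSpaces.Torus.IsSmooth (D.θ m t) := (D.θ_smooth m).isSmooth_slice ⟨by linarith [ht.1], ht.2⟩
    rw [sub_zero, eLpNorm_two_eq_ofReal_sqrt_integral_sq (hθt.memLp 2)]
    exact ENNReal.ofReal_le_ofReal (Real.sqrt_le_sqrt (D.θ_sq_le_θ_one m ht))
  half_lt_ε₀ := by norm_num
  θ_dissipation := D.θ_dissipation
  ρ_smooth := D.ρ_smooth
  θ_sub_ρ := D.θ_sub_ρ
  g_smooth := D.g_smooth
  g_cont := D.g_cont
  g_limit := D.g_limit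

namespace PartialFamilyData

variable (D : PartialFamilyData)

/-! ## Elementary consequences -/

/-- `θ^m` is jointly smooth on `[0,2] × T²`. [folklore] -/
theorem θ_smooth (m : ℕ) : FunctionSpaces.Torus.IsSmoothSpaceTimeOn (Icc 0 2) (D.θ m) :=
  (D.θ_transport m).smooth_scalar

/-- `‖θ^m(t)‖²_{L²} ≤ 1` on `[0, 2]` (energy decay from `‖ρ_in‖ = 1`). [cite: Cheskidov2023, §4 p. 12] -/
theorem θ_sq_le_one (m : ℕ) {t : ℝ} (ht : t ∈ Icc (0 : ℝ) 2) : ∫ x, D.θ m t x ^ 2 ≤ 1 := by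
  have h := D.θ_antitone m (left_mem_Icc.2 (by norm_num)) ht ht.1
  simp only [D.θ_zero m, D.ρin_sq] at h
  exact h

/-- `‖θ^m(t)‖²_{L²} ≤ ‖θ^m(1)‖²_{L²}` for `t ∈ [1, 2]`. [cite: Cheskidov2023, §4 p. 12] -/
theorem θ_sq_le_θ_one (m : ℕ) {t : ℝ} (ht : t ∈ Icc (1 : ℝ) 2) :
    ∫ x, D.θ m t x ^ 2 ≤ ∫ x, D.θ m 1 x ^ 2 :=
  D.θ_antitone m ⟨by norm_num, by norm_num⟩ ⟨by linarith [ht.1], ht.2⟩ ht.1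

/-- `0 ≤ B`. [folklore] -/
theorem B_nonneg : 0 ≤ D.B :=
  (integral_nonneg fun _ => sq_nonneg _).trans (D.v_sq_le 0 0)

/-! ## The cut-off density and drift -/

/-- The cut-off density `θ₁^m(t) = η(t) θ^m(t)` (Cheskidov 2023, §6, p. 18: `θ̃^m η`). [cite: Cheskidov2023, §6 p. 18] -/
def theta1 (m : ℕ) (t : ℝ) (x : 𝕋²) : ℝ := eta t • D.θ m t x

/-- The cut-off drift `v₁^m(t) = η̃(t) v^m(t)` (Cheskidov 2023, §6, p. 18: `ṽ^m η̃`). [cite: Cheskidov2023, §6 p. 18] -/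
def v1 (m : ℕ) (t : ℝ) (x : 𝕋²) : E² := etaTilde t • D.v m t x

/-- `θ₁^m` is jointly smooth on `ℝ × T²` (`supp η ⊂ (0, 2)`). [folklore] -/
theorem theta1_smooth (m : ℕ) : FunctionSpaces.Torus.IsSmoothSpaceTimeOn univ (D.theta1 m) := by
  refine (D.θ_smooth m).cutoff contDiff_eta ?_
  rw [tsupport_eta, interior_Icc]
  exact Icc_subset_Ioo (by norm_num) (by norm_num)

/-- `v₁^m` is jointly smooth on `ℝ × T²`. [folklore] -/
theorem v1_smooth (m : ℕ) : FunctionSpaces.Torus.IsSmoothSpaceTimeOn univ (D.v1 m) :=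
  (D.v_smooth m).cutoff contDiff_etaTilde (by simp)

/-- `θ₁^m(t) = 0` for `t ∉ (9/20, 33/25)` (loose envelope of the sharp `(7/10, 13/10)`, placed inside
the periodisation window `[2/5, 7/5)` as `IsSmoothSpaceTimeOn.timePeriodize` wants). [folklore] -/
theorem theta1_eq_zero (m : ℕ) {t : ℝ} (ht : t ∉ Ioo (9 / 20 : ℝ) (33 / 25)) : D.theta1 m t = 0 := by
  funext x
  rw [theta1, eta_eq_zero fun h => ht ⟨by linarith [h.1], by linarith [h.2]⟩, zero_smul, Pi.zero_apply]

/-- `v₁^m(t) = 0` for `t ∉ (9/20, 33/25)` (`η̃ = 0` for `t ≤ 1/2`, `v^m = 0` for `t ≥ 1`; the same loose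
envelope as for `θ₁^m`). [folklore] -/
theorem v1_eq_zero (m : ℕ) {t : ℝ} (ht : t ∉ Ioo (9 / 20 : ℝ) (33 / 25)) : D.v1 m t = 0 := by
  funext x
  rw [v1, Pi.zero_apply]
  by_cases h : t ≤ 2⁻¹
  · rw [etaTilde_of_le h, zero_smul]
  · rw [D.v_eq_zero m t fun h' => ht ⟨by linarith [h'.1], by linarith [h'.2]⟩, Pi.zero_apply,
      smul_zero]

/-- `∫ θ₁^m(t)² ≤ 1` for all `t`. [cite: Cheskidov2023, §6 p. 18] -/
theorem theta1_sq_le (m : ℕ) (t : ℝ) : ∫ x, D.theta1 m t x ^ 2 ≤ 1 := by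
  by_cases ht : t ∈ Icc (0 : ℝ) 2
  · have h1 : ∀ x, D.theta1 m t x ^ 2 = eta t ^ 2 * D.θ m t x ^ 2 := fun x => by
      rw [theta1, smul_eq_mul, mul_pow]
    simp_rw [h1, integral_const_mul]
    have he := eta_mem_Icc t
    calc eta t ^ 2 * ∫ x, D.θ m t x ^ 2 ≤ 1 * ∫ x, D.θ m t x ^ 2 :=
          mul_le_mul_of_nonneg_right (by nlinarith [he.1, he.2])
            (integral_nonneg fun x => sq_nonneg _)
      _ ≤ 1 := by rw [one_mul]; exact D.θ_sq_le_one m ht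
  · rw [D.theta1_eq_zero m fun h => ht ⟨by linarith [h.1], by linarith [h.2]⟩]
    simp

/-- `∫ ‖v₁^m(t)‖² ≤ B` for all `t`. [cite: Cheskidov2023, §6 (6.5)] -/
theorem v1_sq_le (m : ℕ) (t : ℝ) : ∫ x, ‖D.v1 m t x‖ ^ 2 ≤ D.B := by
  have h1 : ∀ x, ‖D.v1 m t x‖ ^ 2 = etaTilde t ^ 2 * ‖D.v m t x‖ ^ 2 := fun x => by
    rw [v1, norm_smul, mul_pow, Real.norm_eq_abs, sq_abs]
  simp_rw [h1, integral_const_mul]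
  have he := etaTilde_mem_Icc t
  calc etaTilde t ^ 2 * ∫ x, ‖D.v m t x‖ ^ 2 ≤ 1 * ∫ x, ‖D.v m t x‖ ^ 2 :=
        mul_le_mul_of_nonneg_right (by nlinarith [he.1, he.2])
          (integral_nonneg fun x => sq_nonneg _)
    _ ≤ D.B := by rw [one_mul]; exact D.v_sq_le m t

/-- `v₁^m(t)` is divergence free. [folklore] -/
theorem v1_divFree (m : ℕ) (t : ℝ) : FunctionSpaces.Torus.IsDivFree (D.v1 m t) :=
  Torus.isDivFree_const_smul (((D.v_smooth m).isSmooth_slice (mem_univ t)).isContDiff (by simp))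
    (D.v_divFree m t) _

/-- `v₁^m(t)` has zero mean. [folklore] -/
theorem v1_zeroMean (m : ℕ) (t : ℝ) : FunctionSpaces.Torus.HasZeroMean (D.v1 m t) :=
  Torus.hasZeroMean_const_smul (D.v_zeroMean m t) _

/-- `θ₁^m(t)` has zero mean. [folklore] -/
theorem theta1_zeroMean (m : ℕ) (t : ℝ) : FunctionSpaces.Torus.HasZeroMean (D.theta1 m t) := by
  by_cases ht : t ∈ Icc (0 : ℝ) 2
  · exact Torus.hasZeroMean_const_smul (D.θ_zeroMean m t ht) _
  · rw [D.theta1_eq_zero m fun h => ht ⟨by linarith [h.1], by linarith [h.2]⟩]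
    simp [FunctionSpaces.Torus.HasZeroMean]

/-! ## The periodised density and drift -/

/-- The periodised density `θ₂^m = ∑ₙ (η θ^m)(· + n)` (period `1`, window `[2/5, 7/5)`;
Cheskidov 2023, §6, p. 18, `θ^m(t) := ∑ θ̃^m(t+τn) η(t+τn)`). [cite: Cheskidov2023, §6 p. 18] -/
def theta2 (m : ℕ) : ℝ → 𝕋² → ℝ := timePeriodize (2 / 5) 1 (D.theta1 m)

/-- The periodised drift `v₂^m = ∑ₙ (η̃ v^m)(· + n)` (Cheskidov 2023, §6, p. 18,
`v^m(t) := ∑ ṽ^m(t+τn) η̃(t+τn)`). [cite: Cheskidov2023, §6 p. 18] -/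
def v2 (m : ℕ) : ℝ → 𝕋² → E² := timePeriodize (2 / 5) 1 (D.v1 m)

/-- `θ₂^m` is jointly smooth. [cite: Cheskidov2023, §6 p. 18] -/
theorem theta2_smooth (m : ℕ) : FunctionSpaces.Torus.IsSmoothSpaceTimeOn univ (D.theta2 m) :=
  (D.theta1_smooth m).timePeriodize one_pos (by norm_num) (by norm_num) fun _ ht => D.theta1_eq_zero m ht

/-- `v₂^m` is jointly smooth. [cite: Cheskidov2023, §6 p. 18] -/
theorem v2_smooth (m : ℕ) : FunctionSpaces.Torus.IsSmoothSpaceTimeOn univ (D.v2 m) :=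
  (D.v1_smooth m).timePeriodize one_pos (by norm_num) (by norm_num) fun _ ht => D.v1_eq_zero m ht

/-- `θ₂^m` is `1`-periodic. [folklore] -/
theorem theta2_periodic (m : ℕ) : Periodic (D.theta2 m) 1 :=
  Literature.Analysis.FunctionSpaces.periodic_timePeriodize one_pos _

/-- `v₂^m` is `1`-periodic. [folklore] -/
theorem v2_periodic (m : ℕ) : Periodic (D.v2 m) 1 :=
  Literature.Analysis.FunctionSpaces.periodic_timePeriodize one_pos _

/-- `v₂^m(t)` is divergence free. [folklore] -/
theorem v2_divFree (m : ℕ) (t : ℝ) : FunctionSpaces.Torus.IsDivFree (D.v2 m t) :=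
  D.v1_divFree m _

/-- `v₂^m(t)` has zero mean. [folklore] -/
theorem v2_zeroMean (m : ℕ) (t : ℝ) : FunctionSpaces.Torus.HasZeroMean (D.v2 m t) :=
  D.v1_zeroMean m _

/-- `θ₂^m(t)` has zero mean. [folklore] -/
theorem theta2_zeroMean (m : ℕ) (t : ℝ) : FunctionSpaces.Torus.HasZeroMean (D.theta2 m t) :=
  D.theta1_zeroMean m _

/-- `∫ θ₂^m(t)² ≤ 1`. [cite: Cheskidov2023, §6 p. 18] -/
theorem theta2_sq_le (m : ℕ) (t : ℝ) : ∫ x, D.theta2 m t x ^ 2 ≤ 1 := D.theta1_sq_le m _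

/-- `∫ ‖v₂^m(t)‖² ≤ B`. [cite: Cheskidov2023, §6 (6.5)] -/
theorem v2_sq_le (m : ℕ) (t : ℝ) : ∫ x, ‖D.v2 m t x‖ ^ 2 ≤ D.B := D.v1_sq_le m _


/-! ## The scalar force identity (6.7) -/

/-- **(6.7) for the cut-off pair**: `∂ₜθ₁ + v₁·∇θ₁ - νΔθ₁ = η'(t) θ^m(t)` at every time
(Cheskidov 2023, §6, (6.7): `h^m = η'θ̃^m + η(∂ₜθ̃^m + v^m·∇θ̃^m - ν_mΔθ̃^m) = η'θ̃^m`). [cite: Cheskidov2023, (6.7)] -/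
theorem adResidual_v1_theta1 (m : ℕ) (s : ℝ) (y : 𝕋²) :
    Torus.adResidual (D.ν m) (D.v1 m) (D.theta1 m) s y = deriv eta s * D.θ m s y := by
  have hθs : ∀ {s}, s ∈ Icc (0 : ℝ) 2 → FunctionSpaces.Torus.IsSmooth (D.θ m s) := fun hs =>
    (D.θ_smooth m).isSmooth_slice hs
  rw [Torus.adResidual_apply]
  by_cases hs : s ∈ Icc (7 / 10 : ℝ) (13 / 10)
  · -- inside the support window: product rule and the transport equation
    have hs02 : s ∈ Icc (0 : ℝ) 2 := ⟨by linarith [hs.1], by linarith [hs.2]⟩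
    have hsint : s ∈ interior (Icc (0 : ℝ) 2) := by
      rw [interior_Icc]; exact ⟨by linarith [hs.1], by linarith [hs.2]⟩
    have hθ1 : FunctionSpaces.Torus.IsContDiff 1 (D.θ m s) := (hθs hs02).isContDiff (by simp)
    have hder := (D.θ_smooth m).hasDerivAt_slice hsint y
    have ht : FunctionSpaces.Torus.timeDerivWithin univ (D.theta1 m) s y =
        deriv eta s • D.θ m s y + eta s • FunctionSpaces.Torus.timeDerivWithin (Icc 0 2) (D.θ m) s y :=
      Torus.timeDerivWithin_univ_smul hder (hasDerivAt_eta s)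
    have hg : FunctionSpaces.Torus.gradient (D.theta1 m s) y = eta s • FunctionSpaces.Torus.gradient (D.θ m s) y := by
      rw [show D.theta1 m s = fun x => eta s * D.θ m s x from rfl, Torus.gradient_const_mul hθ1]
    have hl : FunctionSpaces.Torus.laplacian (D.theta1 m s) y = eta s • FunctionSpaces.Torus.laplacian (D.θ m s) y := by
      rw [show D.theta1 m s = eta s • D.θ m s from rfl, Torus.laplacian_const_smul' (hθs hs02)]
    have hv : D.v1 m s y = D.v m s y := by
      rw [v1, etaTilde_of_ge (by linarith [hs.1]), one_smul]
    have htr := (D.θ_transport m).transport s hs02 y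
    rw [ht, hg, hl, hv, inner_smul_right]
    simp only [smul_eq_mul]
    have : FunctionSpaces.Torus.timeDerivWithin (Icc 0 2) (D.θ m) s y =
        D.ν m * FunctionSpaces.Torus.laplacian (D.θ m s) y -
          ⟪D.v m s y, FunctionSpaces.Torus.gradient (D.θ m s) y⟫_ℝ := by linarith
    rw [this]
    ring
  · -- off the support window: everything vanishes near `s`
    have h0 : ∀ᶠ r in 𝓝 s, eta r = 0 := by
      filter_upwards [isClosed_Icc.isOpen_compl.mem_nhds hs] with r hr using
        eta_eq_zero fun h' => hr (Ioo_subset_Icc_self h')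
    have hzero : D.theta1 m s = fun _ => (0 : ℝ) := by
      funext x; rw [theta1, eta_eq_zero fun h' => hs (Ioo_subset_Icc_self h'), zero_smul]
    have ht : FunctionSpaces.Torus.timeDerivWithin univ (D.theta1 m) s y = 0 := by
      rw [FunctionSpaces.Torus.timeDerivWithin, derivWithin_univ]
      have heq : (fun r => D.theta1 m r y) =ᶠ[𝓝 s] fun _ => (0 : ℝ) :=
        h0.mono fun r hr => by simp only [theta1, hr, zero_smul]
      rw [heq.deriv_eq, deriv_const]
    rw [ht, hzero, Torus.gradient_zero, Torus.laplacian_zero,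
      deriv_eta_eq_zero (Or.inr fun h' => hs (Ioo_subset_Icc_self h'))]
    simp

/-- **(6.7), periodised**: the advection–diffusion residual of `(v₂^m, θ₂^m)` is the
`1`-periodisation of `η' θ^m` (time derivatives commute with the periodisation of fields supported
in the open window, `Torus.timeDerivWithin_timePeriodize`; the other terms are slice-wise). [cite: Cheskidov2023, (6.7)] -/
theorem adResidual_v2_theta2 (m : ℕ) (t : ℝ) (y : 𝕋²) :
    Torus.adResidual (D.ν m) (D.v2 m) (D.theta2 m) t y =
      timePeriodize (2 / 5) 1 (fun s x => deriv eta s * D.θ m s x) t y := by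
  rw [Torus.adResidual_apply, theta2, v2,
    FunctionSpaces.Torus.timeDerivWithin_timePeriodize one_pos (by norm_num) (by norm_num)
      (fun _ ht => D.theta1_eq_zero m ht)]
  simp only [timePeriodize_apply]
  rw [← D.adResidual_v1_theta1 m, Torus.adResidual_apply]

/-! ## The drift force identity -/

/-- The correction `K^m = η̃' • v^m + (η̃² - η̃) • (v^m·∇)v^m` in the body force of the cut-off
drift (supported in `1/2 ≤ t ≤ 2/3`). [folklore] -/
def K (m : ℕ) (t : ℝ) (y : 𝕋²) : E² :=
  deriv etaTilde t • D.v m t y +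
    (etaTilde t ^ 2 - etaTilde t) • FunctionSpaces.Torus.convect (D.v m t) (D.v m t) y

/-- **Body force of the cut-off drift**:
`∂ₜv₁ + (v₁·∇)v₁ - νΔv₁ = η̃ • (∂ₜv + (v·∇)v - νΔv) + K` (product rule in time, bilinearity of
the convective term, linearity of `Δ`). [cite: Cheskidov2023, §6 p. 18] -/
theorem nsBodyForce_v1 (m : ℕ) (s : ℝ) (y : 𝕋²) :
    Torus.nsBodyForce (D.ν m) (D.v1 m) s y =
      etaTilde s • Torus.nsBodyForce (D.ν m) (D.v m) s y + D.K m s y := by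
  have hvs : FunctionSpaces.Torus.IsSmooth (D.v m s) := (D.v_smooth m).isSmooth_slice (mem_univ s)
  have hv1 : FunctionSpaces.Torus.IsContDiff 1 (D.v m s) := hvs.isContDiff (by simp)
  have hder : HasDerivAt (fun r => D.v m r y) (FunctionSpaces.Torus.timeDerivWithin univ (D.v m) s y) s :=
    (D.v_smooth m).hasDerivAt_slice (by simp) y
  have ht : FunctionSpaces.Torus.timeDerivWithin univ (D.v1 m) s y =
      deriv etaTilde s • D.v m s y + etaTilde s • FunctionSpaces.Torus.timeDerivWithin univ (D.v m) s y :=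
    Torus.timeDerivWithin_univ_smul hder (hasDerivAt_etaTilde s)
  have hc : FunctionSpaces.Torus.convect (D.v1 m s) (D.v1 m s) y =
      etaTilde s ^ 2 • FunctionSpaces.Torus.convect (D.v m s) (D.v m s) y := by
    simp only [FunctionSpaces.Torus.convect]
    rw [show D.v1 m s = etaTilde s • D.v m s from rfl, FunctionSpaces.Torus.fderiv_const_smul hv1,
      FunLike.coe_smul, Pi.smul_apply, Pi.smul_apply, map_smul, smul_smul, sq]
  have hl : FunctionSpaces.Torus.laplacian (D.v1 m s) y = etaTilde s • FunctionSpaces.Torus.laplacian (D.v m s) y := by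
    rw [show D.v1 m s = etaTilde s • D.v m s from rfl, Torus.laplacian_const_smul' hvs]
  rw [Torus.nsBodyForce_apply, Torus.nsBodyForce_apply, ht, hc, hl, K]
  module

/-- `K^m(t) = 0` for `t ≥ 2/3` (`η̃ = 1`, `η̃' = 0`). [folklore] -/
theorem K_eq_zero_of_ge (m : ℕ) {t : ℝ} (ht : 2 / 3 ≤ t) : D.K m t = 0 := by
  funext y
  simp [K, deriv_etaTilde_eq_zero (Or.inr ht), etaTilde_of_ge ht]

/-- `K^m(t) = 0` for `t ≤ 1/2` (`η̃ = 0`, `η̃' = 0`). [folklore] -/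
theorem K_eq_zero_of_le (m : ℕ) {t : ℝ} (ht : t ≤ 2⁻¹) : D.K m t = 0 := by
  funext y
  simp [K, deriv_etaTilde_eq_zero (Or.inl ht), etaTilde_of_le ht]

/-- `K^m` is jointly smooth on `ℝ × T²`. [folklore] -/
theorem K_smooth (m : ℕ) : FunctionSpaces.Torus.IsSmoothSpaceTimeOn univ (D.K m) := by
  have h1 : FunctionSpaces.Torus.IsSmoothSpaceTimeOn univ (fun t y => deriv etaTilde t • D.v m t y) :=
    (D.v_smooth m).cutoff (contDiff_infty_iff_deriv.mp contDiff_etaTilde).2 (by simp)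
  have h2 : FunctionSpaces.Torus.IsSmoothSpaceTimeOn univ (fun t y => (etaTilde t ^ 2 - etaTilde t) •
      FunctionSpaces.Torus.convect (D.v m t) (D.v m t) y) :=
    ((D.v_smooth m).convect (D.v_smooth m) uniqueDiffOn_univ).cutoff
      ((contDiff_etaTilde.pow 2).sub contDiff_etaTilde) (by simp)
  exact h1.add h2

/-- `K^m(t)` has zero mean. [folklore] -/
theorem K_zeroMean (m : ℕ) (t : ℝ) : FunctionSpaces.Torus.HasZeroMean (D.K m t) := by
  have hvt : FunctionSpaces.Torus.IsSmooth (D.v m t) := (D.v_smooth m).isSmooth_slice (mem_univ t)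
  unfold FunctionSpaces.Torus.HasZeroMean
  simp only [K]
  rw [integral_add, integral_smul, integral_smul]
  · have h1 : ∫ y, D.v m t y = 0 := D.v_zeroMean m t
    have h2 : ∫ y, FunctionSpaces.Torus.convect (D.v m t) (D.v m t) y = 0 :=
      FunctionSpaces.Torus.integral_fderiv_apply_eq_zero_of_isDivFree hvt hvt (D.v_divFree m t)
    rw [h1, h2, smul_zero, smul_zero, add_zero]
  · exact hvt.integrable.smul (deriv etaTilde t)
  · exact (hvt.convect hvt).integrable.smul (etaTilde t ^ 2 - etaTilde t)

/-- **Stationarity of the correction**: there is `m₁` with `K^m = K^{m₁}` for all `m ≥ m₁`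
(the drifts agree on `t ≤ 3/4` for `m ≥ m₁`, and `K = 0` for `t ≥ 2/3`). [cite: Cheskidov2023, §6 p. 18] -/
theorem K_stationary : ∃ m₁ : ℕ, ∀ m ≥ m₁, D.K m = D.K m₁ := by
  obtain ⟨m₁, hm₁⟩ := D.v_stationary (3 / 4) (by norm_num)
  refine ⟨m₁, fun m hm => ?_⟩
  funext t y
  by_cases ht : t ≤ 3 / 4
  · simp only [K, hm₁ m hm t ht]
  · rw [D.K_eq_zero_of_ge m (by linarith), D.K_eq_zero_of_ge m₁ (by linarith)]

/-- **Body force of the periodised drift**: the `1`-periodisation of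
`η̃ • g^m + K^m`, `g^m = ∂ₜv^m + (v^m·∇)v^m - ν_mΔv^m`. [cite: Cheskidov2023, §6 p. 18] -/
theorem nsBodyForce_v2 (m : ℕ) (t : ℝ) (y : 𝕋²) :
    Torus.nsBodyForce (D.ν m) (D.v2 m) t y =
      timePeriodize (2 / 5) 1
        (fun s x => etaTilde s • Torus.nsBodyForce (D.ν m) (D.v m) s x + D.K m s x) t y := by
  rw [Torus.nsBodyForce_apply, v2,
    FunctionSpaces.Torus.timeDerivWithin_timePeriodize one_pos (by norm_num) (by norm_num)
      (fun _ ht => D.v1_eq_zero m ht)]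
  simp only [timePeriodize_apply]
  rw [← D.nsBodyForce_v1 m, Torus.nsBodyForce_apply]

/-- The body force of the periodised drift is jointly smooth. [folklore] -/
theorem nsBodyForce_v2_smooth (m : ℕ) :
    FunctionSpaces.Torus.IsSmoothSpaceTimeOn univ (Torus.nsBodyForce (D.ν m) (D.v2 m)) := by
  have h := D.v2_smooth m
  have e : Torus.nsBodyForce (D.ν m) (D.v2 m) = fun t y =>
      FunctionSpaces.Torus.timeDerivWithin univ (D.v2 m) t y +
        FunctionSpaces.Torus.convect (D.v2 m t) (D.v2 m t) y - D.ν m • FunctionSpaces.Torus.laplacian (D.v2 m t) y := by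
    funext t y; rfl
  rw [e]
  exact ((h.timeDerivWithin uniqueDiffOn_univ).add (h.convect h uniqueDiffOn_univ)).sub
    ((h.laplacian uniqueDiffOn_univ).const_smul _)

/-- The body force of the periodised drift is `1`-periodic. [folklore] -/
theorem nsBodyForce_v2_periodic (m : ℕ) : Periodic (Torus.nsBodyForce (D.ν m) (D.v2 m)) 1 :=
  Torus.periodic_nsBodyForce (D.v2_periodic m)

/-- The body force of the periodised drift has zero mean at all times. [folklore] -/
theorem nsBodyForce_v2_zeroMean (m : ℕ) (t : ℝ) :
    FunctionSpaces.Torus.HasZeroMean (Torus.nsBodyForce (D.ν m) (D.v2 m) t) :=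
  Torus.hasZeroMean_nsBodyForce (D.v2_smooth m) (D.v2_divFree m) (D.v2_zeroMean m) t

/-- The advection–diffusion residual of `(v₂^m, θ₂^m)` is jointly smooth. [folklore] -/
theorem adResidual_v2_theta2_smooth (m : ℕ) :
    FunctionSpaces.Torus.IsSmoothSpaceTimeOn univ (Torus.adResidual (D.ν m) (D.v2 m) (D.theta2 m)) := by
  have hv := D.v2_smooth m
  have hθ := D.theta2_smooth m
  have e : Torus.adResidual (D.ν m) (D.v2 m) (D.theta2 m) = fun t y =>
      FunctionSpaces.Torus.timeDerivWithin univ (D.theta2 m) t y +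
        ⟪D.v2 m t y, FunctionSpaces.Torus.gradient (D.theta2 m t) y⟫_ℝ -
          D.ν m * FunctionSpaces.Torus.laplacian (D.theta2 m t) y := by
    funext t y; rfl
  rw [e]
  exact ((hθ.timeDerivWithin uniqueDiffOn_univ).add (hv.inner (hθ.gradient uniqueDiffOn_univ))).sub
    ((FunctionSpaces.Torus.isSmoothSpaceTimeOn_const (FunctionSpaces.Torus.isSmooth_const (D.ν m))
      univ).smul (hθ.laplacian uniqueDiffOn_univ))

/-- The residual is `1`-periodic. [folklore] -/
theorem adResidual_v2_theta2_periodic (m : ℕ) :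
    Periodic (Torus.adResidual (D.ν m) (D.v2 m) (D.theta2 m)) 1 := fun t => by
  funext y
  rw [D.adResidual_v2_theta2, D.adResidual_v2_theta2,
    Literature.Analysis.FunctionSpaces.periodic_timePeriodize one_pos _ t]

/-- The residual has zero mean at all times (`∫ η'(s) θ^m(s) = η'(s) ∫ θ^m(s) = 0` for
`s ∈ [0,2]`, and `η'(s) = 0` otherwise). [folklore] -/
theorem adResidual_v2_theta2_zeroMean (m : ℕ) (t : ℝ) :
    FunctionSpaces.Torus.HasZeroMean (Torus.adResidual (D.ν m) (D.v2 m) (D.theta2 m) t) := by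
  have e : Torus.adResidual (D.ν m) (D.v2 m) (D.theta2 m) t =
      fun y => deriv eta (timeWrap (2 / 5) 1 t) * D.θ m (timeWrap (2 / 5) 1 t) y := by
    funext y; rw [D.adResidual_v2_theta2]; rfl
  rw [e]
  set s := timeWrap (2 / 5) 1 t
  unfold FunctionSpaces.Torus.HasZeroMean
  rw [integral_const_mul]
  by_cases hs : s ∈ Icc (0 : ℝ) 2
  · rw [show (∫ y, D.θ m s y) = 0 from D.θ_zeroMean m s hs, mul_zero]
  · rw [deriv_eta_eq_zero (Or.inr fun h => hs ⟨by linarith [h.1], by linarith [h.2]⟩), zero_mul]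


/-! ## The limit drift force -/

/-- An index from which on the correction `K^m` is stationary. [folklore] -/
def mK : ℕ := Classical.choose D.K_stationary

/-- `K^m = K^{mK}` for `m ≥ mK`. [folklore] -/
theorem K_eq_K_mK {m : ℕ} (hm : D.mK ≤ m) : D.K m = D.K D.mK :=
  Classical.choose_spec D.K_stationary m hm

/-- The window limit drift force `Gw = η̃ • g + K^{mK}` on `ℝ × T²` (Cheskidov 2023, §6: the limit
of the body forces of the periodised drifts, before periodisation). [cite: Cheskidov2023, §6 p. 18] -/
def Gw (t : ℝ) (y : 𝕋²) : E² := etaTilde t • D.g t y + D.K D.mK t y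

/-- The limit drift force `Ginf = ∑ₙ Gw(· + n)` (`1`-periodisation from the window `[2/5, 7/5)`). [cite: Cheskidov2023, §6 p. 18] -/
def Ginf : ℝ → 𝕋² → E² := timePeriodize (2 / 5) 1 D.Gw

/-- Slices of `Gw` are smooth. [folklore] -/
theorem Gw_smooth_slice (t : ℝ) : FunctionSpaces.Torus.IsSmooth (D.Gw t) :=
  ((D.g_smooth t).const_smul (etaTilde t)).add ((D.K_smooth D.mK).isSmooth_slice (mem_univ t))

/-- Slices of `Ginf` are smooth. [folklore] -/
theorem Ginf_smooth_slice (t : ℝ) : FunctionSpaces.Torus.IsSmooth (D.Ginf t) := D.Gw_smooth_slice _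

/-- `Ginf` is `1`-periodic. [folklore] -/
theorem Ginf_periodic : Periodic D.Ginf 1 :=
  Literature.Analysis.FunctionSpaces.periodic_timePeriodize one_pos _

/-- `Gw(2/5) = 0` (`η̃(2/5) = 0`, `K(2/5) = 0`). [folklore] -/
theorem Gw_two_fifths : D.Gw (2 / 5) = 0 := by
  funext y
  rw [Gw, etaTilde_of_le (by norm_num), zero_smul, zero_add, D.K_eq_zero_of_le _ (by norm_num)]

/-- For `t > 1` the body forces `g^m(t)` vanish identically (the drifts vanish on the open set
`(1, ∞)`), hence the limit force is `L²`-null there: `‖g(t)‖_{L²} = 0`. [folklore] -/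
theorem eLpNorm_g_eq_zero {t : ℝ} (ht : 1 < t) : eLpNorm (D.g t) 2 volume = 0 := by
  have hzero : ∀ m, Torus.nsBodyForce (D.ν m) (D.v m) t = 0 := fun m => by
    funext y
    have h0 : ∀ᶠ s in 𝓝 t, D.v m s = 0 := by
      filter_upwards [Ioi_mem_nhds ht] with s hs using D.v_eq_zero m s fun h => by linarith [h.2, mem_Ioi.1 hs]
    have hd : FunctionSpaces.Torus.timeDerivWithin univ (D.v m) t y = 0 := by
      rw [FunctionSpaces.Torus.timeDerivWithin, derivWithin_univ]
      have heq : (fun s => D.v m s y) =ᶠ[𝓝 t] fun _ => (0 : E²) := h0.mono fun s hs => by simp [hs]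
      rw [heq.deriv_eq, deriv_const]
    have hv : D.v m t = fun _ => (0 : E²) := by funext x; simp [h0.self_of_nhds]
    rw [Torus.nsBodyForce_apply, hd, hv, Pi.zero_apply]
    simp [FunctionSpaces.Torus.convect, FunctionSpaces.Torus.fderiv]
  have hle : ∀ m, eLpNorm (D.g t) 2 volume ≤
      ⨆ s : ℝ, eLpNorm (Torus.nsBodyForce (D.ν m) (D.v m) s - D.g s) 2 volume := fun m => by
    calc eLpNorm (D.g t) 2 volume = eLpNorm (Torus.nsBodyForce (D.ν m) (D.v m) t - D.g t) 2 volume := by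
          rw [hzero m, zero_sub, eLpNorm_neg]
      _ ≤ ⨆ s : ℝ, eLpNorm (Torus.nsBodyForce (D.ν m) (D.v m) s - D.g s) 2 volume :=
          le_iSup (fun s => eLpNorm (Torus.nsBodyForce (D.ν m) (D.v m) s - D.g s) 2 volume) t
  exact le_antisymm (ge_of_tendsto' D.g_limit hle) zero_le

/-- `Gw` is continuous in time with values in `L²`. [folklore] -/
theorem Gw_continuousInLpOn : Torus.ContinuousInLpOn univ 2 D.Gw :=
  (Torus.ContinuousInLpOn.smul_continuousOn one_le_two D.g_cont (contDiff_etaTilde (n := 0)).continuous.continuousOn).add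
    one_le_two ((D.K_smooth D.mK).continuousInLpOn 2)

/-- **`Ginf ∈ C(ℝ; L²)`**. [cite: Cheskidov2023, §6 p. 18] -/
theorem Ginf_continuousInLpOn : Torus.ContinuousInLpOn univ 2 D.Ginf := by
  refine Torus.continuousInLpOn_timePeriodize one_pos D.Gw_continuousInLpOn ?_
  simp only [D.Gw_two_fifths, sub_zero]
  -- near `7/5` from the left, `Gw = g` has vanishing `L²` norm
  have h : ∀ᶠ s in 𝓝[<] ((2 / 5 : ℝ) + 1), eLpNorm (D.Gw s) 2 volume = 0 := by
    have hI : Ioo (1 : ℝ) (2 / 5 + 1) ∈ 𝓝[<] ((2 / 5 : ℝ) + 1) := Ioo_mem_nhdsLT (by norm_num)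
    filter_upwards [hI] with s hs
    have hs23 : 2 / 3 ≤ s := by linarith [hs.1]
    have : D.Gw s = D.g s := by
      funext y; rw [Gw, etaTilde_of_ge hs23, one_smul, D.K_eq_zero_of_ge _ hs23, Pi.zero_apply, add_zero]
    rw [this, D.eLpNorm_g_eq_zero hs.1]
  exact tendsto_const_nhds.congr' (h.mono fun s hs => hs.symm)

/-- **Convergence of the drift forces**: `sup_t ‖(∂ₜv₂^m + (v₂^m·∇)v₂^m - ν_mΔv₂^m)(t) - Ginf(t)‖_{L²} → 0`
(the paper, §6 p. 18, asks that "the resulting force converges in `L^∞(ℝ; L²)`"; the input is the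
`g_limit` clause `g^m → g` of the family fact). For `m ≥ mK` the difference is the periodisation of
`η̃ • (g^m - g)`. [cite: Cheskidov2023, §6 p. 18] -/
theorem tendsto_nsBodyForce_v2_sub_Ginf :
    Tendsto (fun m => ⨆ t : ℝ, eLpNorm (Torus.nsBodyForce (D.ν m) (D.v2 m) t - D.Ginf t) 2 volume)
      atTop (𝓝 0) := by
  refine tendsto_of_tendsto_of_tendsto_of_le_of_le' tendsto_const_nhds D.g_limit
    (Eventually.of_forall fun m => zero_le) ?_
  filter_upwards [eventually_ge_atTop D.mK] with m hm
  refine iSup_le fun t => ?_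
  set s := timeWrap (2 / 5) 1 t
  have hdiff : Torus.nsBodyForce (D.ν m) (D.v2 m) t - D.Ginf t =
      etaTilde s • (Torus.nsBodyForce (D.ν m) (D.v m) s - D.g s) := by
    funext y
    rw [Pi.sub_apply, D.nsBodyForce_v2, timePeriodize_apply, Ginf, timePeriodize_apply, Gw,
      D.K_eq_K_mK hm]
    simp only [Pi.smul_apply, Pi.sub_apply, smul_sub]
    abel
  rw [hdiff, eLpNorm_const_smul]
  have he : ‖etaTilde s‖ₑ ≤ 1 := by
    rw [← ofReal_norm, Real.norm_eq_abs, abs_of_nonneg (etaTilde_mem_Icc s).1]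
    exact ENNReal.ofReal_le_one.2 (etaTilde_mem_Icc s).2
  calc ‖etaTilde s‖ₑ * eLpNorm (Torus.nsBodyForce (D.ν m) (D.v m) s - D.g s) 2 volume
      ≤ 1 * eLpNorm (Torus.nsBodyForce (D.ν m) (D.v m) s - D.g s) 2 volume := by gcongr
    _ ≤ ⨆ r : ℝ, eLpNorm (Torus.nsBodyForce (D.ν m) (D.v m) r - D.g r) 2 volume := by
        rw [one_mul]
        exact le_iSup (fun r => eLpNorm (Torus.nsBodyForce (D.ν m) (D.v m) r - D.g r) 2 volume) s

/-! ## The limit scalar force -/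

/-- The window limit scalar force `Hw(t) = χ(t) ρ̃(t) + χ_late(t) R`: before the blow-up time the
smooth realisation of `h = η'(t) ρ̃(t) χ_{[1-τ/3, 1-τ/4]}(t)` (Cheskidov 2023, §6, p. 18), and on
the ramp-down window `η'(t) R` — the term that vanishes in the total-dissipation case. [cite: Cheskidov2023, §6 p. 18] -/
def Hw (t : ℝ) (y : 𝕋²) : ℝ := chi t • D.ρ t y + chiLate t * D.R y

/-- The limit scalar force `Hinf = ∑ₙ Hw(· + n)` (the paper's `h = ∑_{n} η'(t-n) ρ̃(t-n) χ(t-n)`,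
p. 18, written there with `n ∈ 2ℤ`, an evident slip for `τℤ`; here `τ = 1`). [cite: Cheskidov2023, §6 p. 18] -/
def Hinf : ℝ → 𝕋² → ℝ := timePeriodize (2 / 5) 1 D.Hw

/-- The smooth part `χ(t) ρ̃(t)` of `Hw` is jointly smooth on `ℝ × T²` (`supp χ ⊂ (0,1)`, where
`ρ̃` is smooth). [folklore] -/
theorem Hw_smooth_part : FunctionSpaces.Torus.IsSmoothSpaceTimeOn univ (fun t y => chi t • D.ρ t y) := by
  refine D.ρ_smooth.cutoff contDiff_chi ?_
  rw [interior_Ico]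
  exact tsupport_chi_subset.trans (Icc_subset_Ioo (by norm_num) (by norm_num))

/-- Unfolding `Hw` as the sum of its two parts. [folklore] -/
theorem Hw_eq_add : D.Hw = fun t => (fun y => chi t • D.ρ t y) + fun y => chiLate t * D.R y := by
  funext t y; rfl

/-- Slices of `Hw` are in `L²`. [folklore] -/
theorem Hw_memLp (t : ℝ) : MemLp (D.Hw t) 2 volume := by
  rw [D.Hw_eq_add]
  exact ((D.Hw_smooth_part.isSmooth_slice (mem_univ t)).memLp 2).add (D.R_memLp.const_mul _)

/-- Slices of `Hw` are a.e. strongly measurable. [folklore] -/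
theorem Hw_aestronglyMeasurable (t : ℝ) : AEStronglyMeasurable (D.Hw t) volume :=
  (D.Hw_memLp t).aestronglyMeasurable

/-- `Hw(t) = 0` for `t ∉ (9/20, 33/25)`. [folklore] -/
theorem Hw_eq_zero {t : ℝ} (ht : t ∉ Ioo (9 / 20 : ℝ) (33 / 25)) : D.Hw t = 0 := by
  have hct : chi t = 0 := by
    by_contra h
    have := tsupport_chi_subset (subset_tsupport _ (mem_support.2 h))
    exact ht ⟨by linarith [this.1], by linarith [this.2]⟩
  have hlt : chiLate t = 0 := chiLate_eq_zero_of_not_mem fun h => ht ⟨by linarith [h.1], by linarith [h.2]⟩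
  funext y
  rw [Hw, hct, hlt, zero_smul, zero_mul, add_zero, Pi.zero_apply]

/-- `Hw` is continuous in time with values in `L²` (smooth part, plus a continuous scalar
multiple of the fixed `R ∈ L²`). [folklore] -/
theorem Hw_continuousInLpOn : Torus.ContinuousInLpOn univ 2 D.Hw := by
  rw [D.Hw_eq_add]
  refine (D.Hw_smooth_part.continuousInLpOn 2).add one_le_two ?_
  have hR : Torus.ContinuousInLpOn univ 2 (fun _ : ℝ => D.R) :=
    ⟨fun _ _ => D.R_memLp, fun t _ => by simp⟩
  have h := Torus.ContinuousInLpOn.smul_continuousOn one_le_two hR continuous_chiLate.continuousOn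
  refine ⟨fun t ht => ?_, fun t ht => ?_⟩
  · simpa [smul_eq_mul] using h.1 t ht
  · have := h.2 t ht
    simpa [smul_eq_mul] using this

/-- Slices of `Hinf` are a.e. strongly measurable. [folklore] -/
theorem Hinf_aestronglyMeasurable (t : ℝ) : AEStronglyMeasurable (D.Hinf t) volume := by
  rw [Hinf, timePeriodize_apply]
  exact D.Hw_aestronglyMeasurable _

/-- **`Hinf ∈ C(ℝ; L²)`**. [cite: Cheskidov2023, §6 p. 18] -/
theorem Hinf_continuousInLpOn : Torus.ContinuousInLpOn univ 2 D.Hinf := by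
  refine Torus.continuousInLpOn_timePeriodize one_pos D.Hw_continuousInLpOn ?_
  have h0 : D.Hw (2 / 5) = 0 := D.Hw_eq_zero fun h => by linarith [h.1]
  simp only [h0, sub_zero]
  have h : ∀ᶠ s in 𝓝[<] ((2 / 5 : ℝ) + 1), eLpNorm (D.Hw s) 2 volume = 0 := by
    have hI : Ioo (33 / 25 : ℝ) (2 / 5 + 1) ∈ 𝓝[<] ((2 / 5 : ℝ) + 1) := Ioo_mem_nhdsLT (by norm_num)
    filter_upwards [hI] with s hs
    rw [D.Hw_eq_zero fun h => by linarith [h.2, hs.1], eLpNorm_zero]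
  exact tendsto_const_nhds.congr' (h.mono fun s hs => hs.symm)

/-- `Hinf` is `1`-periodic. [folklore] -/
theorem Hinf_periodic : Periodic D.Hinf 1 :=
  Literature.Analysis.FunctionSpaces.periodic_timePeriodize one_pos _

/-- **Pointwise-in-time bound for the scalar forces before the blow-up time**: for `s ≤ 5/4`,
`‖η'(s)θ^m(s) - χ(s)ρ̃(s)‖_{L²} ≤ M sup_{t ∈ [0, 3/4]} ‖θ^m(t) - ρ̃(t)‖_{L²}` (`M = derivEtaBound`) (on `supp η' ∩ {s<1}
⊂ (7/10, 3/4)` we have `χ = η'`; elsewhere both sides vanish). [cite: Cheskidov2023, §6 p. 18] -/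
theorem eLpNorm_scalar_diff_le_early (m : ℕ) {s : ℝ} (hs : s ≤ 5 / 4) :
    eLpNorm (fun y => deriv eta s * D.θ m s y - D.Hw s y) 2 volume ≤
      ENNReal.ofReal derivEtaBound * ⨆ t ∈ Icc (0 : ℝ) (3 / 4), eLpNorm (D.θ m t - D.ρ t) 2 volume := by
  by_cases h : s ∈ Ioo (7 / 10 : ℝ) (3 / 4)
  · have hchi : chi s = deriv eta s := chi_of_le (by linarith [h.2])
    have hlt : chiLate s = 0 := chiLate_eq_zero_of_le (by linarith [h.2])
    have heq : (fun y => deriv eta s * D.θ m s y - D.Hw s y) = deriv eta s • (D.θ m s - D.ρ s) := by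
      funext y; simp only [Hw, hchi, hlt, zero_mul, add_zero, Pi.smul_apply, Pi.sub_apply, smul_eq_mul, mul_sub]
    rw [heq, eLpNorm_const_smul, ← ofReal_norm, Real.norm_eq_abs]
    exact mul_le_mul' (ENNReal.ofReal_le_ofReal (derivEtaBound_spec.2 s))
      (le_biSup (fun t => eLpNorm (D.θ m t - D.ρ t) 2 volume) ⟨by linarith [h.1], h.2.le⟩)
  · have hd : deriv eta s = 0 := by
      rcases le_or_gt s (7 / 10) with h1 | h1
      · exact deriv_eta_eq_zero (Or.inr fun h' => by linarith [h'.1])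
      · exact deriv_eta_eq_zero (Or.inl ⟨not_lt.1 fun h2 => h ⟨h1, h2⟩, hs⟩)
    have hc : chi s = 0 := by rw [chi, hd, zero_mul]
    have hlt : chiLate s = 0 := by rw [chiLate, hd, zero_mul]
    have hz : (fun y => deriv eta s * D.θ m s y - D.Hw s y) = 0 := by
      funext y; simp [Hw, hd, hc, hlt]
    rw [hz, eLpNorm_zero]
    exact zero_le

/-- **Pointwise-in-time bound for the scalar forces after the blow-up time**: for
`s ∈ [1, 2]`, `‖η'(s)θ^m(s) - Hw(s)‖_{L²} ≤ M sup_{t ∈ [1,2]} ‖θ^m(t) - R‖_{L²}` (`χ = 0` and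
`χ_late = η'` there, so the difference is `η'(s)(θ^m(s) - R)`). [cite: Cheskidov2023, §6 p. 18] -/
theorem eLpNorm_scalar_diff_le_late (m : ℕ) {s : ℝ} (hs : s ∈ Icc (1 : ℝ) 2) :
    eLpNorm (fun y => deriv eta s * D.θ m s y - D.Hw s y) 2 volume ≤
      ENNReal.ofReal derivEtaBound * ⨆ t ∈ Icc (1 : ℝ) 2, eLpNorm (D.θ m t - D.R) 2 volume := by
  have hc : chi s = 0 := chi_of_ge (by linarith [hs.1])
  have hlt : chiLate s = deriv eta s := chiLate_eq_deriv_eta hs.1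
  have heq : (fun y => deriv eta s * D.θ m s y - D.Hw s y) = deriv eta s • (D.θ m s - D.R) := by
    funext y; simp only [Hw, hc, hlt, smul_eq_mul, zero_mul, zero_add, Pi.smul_apply, Pi.sub_apply, mul_sub]
  rw [heq, eLpNorm_const_smul, ← ofReal_norm, Real.norm_eq_abs]
  exact mul_le_mul' (ENNReal.ofReal_le_ofReal (derivEtaBound_spec.2 s))
    (le_biSup (fun t => eLpNorm (D.θ m t - D.R) 2 volume) hs)

/-- **Convergence of the scalar forces** (Cheskidov 2023, §6, `h^m → h` in `L^∞(ℝ; L²)`):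
`sup_t ‖h^m(t) - Hinf(t)‖_{L²} → 0`, where `h^m` is the advection–diffusion residual of
`(v₂^m, θ₂^m)` (the periodisation of `η' θ^m`, (6.7)). [cite: Cheskidov2023, §6 p. 18] -/
theorem tendsto_adResidual_sub_Hinf :
    Tendsto (fun m => ⨆ t : ℝ, eLpNorm (Torus.adResidual (D.ν m) (D.v2 m) (D.theta2 m) t - D.Hinf t) 2 volume)
      atTop (𝓝 0) := by
  -- the two bounds tend to zero
  have hE : Tendsto (fun m => ENNReal.ofReal derivEtaBound * ⨆ t ∈ Icc (0 : ℝ) (3 / 4), eLpNorm (D.θ m t - D.ρ t) 2 volume)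
      atTop (𝓝 0) := by
    have h := ENNReal.Tendsto.const_mul (D.θ_sub_ρ (3 / 4) ⟨by norm_num, by norm_num⟩)
      (a := ENNReal.ofReal derivEtaBound) (Or.inr ENNReal.ofReal_ne_top)
    rwa [mul_zero] at h
  have hL : Tendsto (fun m => ENNReal.ofReal derivEtaBound * ⨆ t ∈ Icc (1 : ℝ) 2, eLpNorm (D.θ m t - D.R) 2 volume)
      atTop (𝓝 0) := by
    have h := ENNReal.Tendsto.const_mul D.θ_late (a := ENNReal.ofReal derivEtaBound) (Or.inr ENNReal.ofReal_ne_top)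
    rwa [mul_zero] at h
  have hsum := hE.add hL
  rw [add_zero] at hsum
  refine tendsto_of_tendsto_of_tendsto_of_le_of_le' tendsto_const_nhds hsum
    (Eventually.of_forall fun m => zero_le) (Eventually.of_forall fun m => ?_)
  -- reduce the supremum over all times to the window
  have hper : (fun t => Torus.adResidual (D.ν m) (D.v2 m) (D.theta2 m) t - D.Hinf t) =
      timePeriodize (2 / 5) 1 (fun s => (fun y => deriv eta s * D.θ m s y - D.Hw s y)) := by
    funext t y
    rw [Pi.sub_apply, D.adResidual_v2_theta2, Hinf, timePeriodize_apply, timePeriodize_apply, timePeriodize_apply]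
  rw [show (⨆ t : ℝ, eLpNorm (Torus.adResidual (D.ν m) (D.v2 m) (D.theta2 m) t - D.Hinf t) 2 volume) =
      ⨆ t : ℝ, eLpNorm ((fun t => Torus.adResidual (D.ν m) (D.v2 m) (D.theta2 m) t - D.Hinf t) t) 2 volume
      from rfl, hper,
    Literature.Analysis.FunctionSpaces.iSup_comp_timePeriodize one_pos _ fun G => eLpNorm G 2 volume]
  refine iSup₂_le fun s hs => ?_
  rcases le_or_gt s 1 with h | h
  · exact (D.eLpNorm_scalar_diff_le_early m (by linarith)).trans le_self_add
  · exact (D.eLpNorm_scalar_diff_le_late m ⟨h.le, by linarith [hs.2]⟩).trans le_add_self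

section Helmholtz

variable (hH : FunctionSpaces.Torus.smooth_leray_helmholtz (Fin 2))


/-! ## The solenoidal part of the body force of the periodised drift -/

/-- The solenoidal part `wF^m` of the body force of `v₂^m` (Leray–Helmholtz, via `hH`). [cite: Cheskidov2023, §6 p. 18] -/
def wF (m : ℕ) : ℝ → 𝕋² → E² := Classical.choose (hH _ (D.nsBodyForce_v2_smooth m))

/-- The mean-zero potential `phiF^m` of the gradient part of the body force of `v₂^m`. [cite: Cheskidov2023, §6 p. 18] -/
def phiF (m : ℕ) : ℝ → 𝕋² → ℝ :=
  Classical.choose (Classical.choose_spec (hH _ (D.nsBodyForce_v2_smooth m)))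

/-- The defining properties of `(wF^m, phiF^m)`. [folklore] -/
theorem wF_spec (m : ℕ) :
    FunctionSpaces.Torus.IsSmoothSpaceTimeOn univ (D.wF hH m) ∧
      FunctionSpaces.Torus.IsSmoothSpaceTimeOn univ (D.phiF hH m) ∧
      (∀ t, FunctionSpaces.Torus.IsDivFree (D.wF hH m t)) ∧
      (∀ t, FunctionSpaces.Torus.HasZeroMean (D.phiF hH m t)) ∧
      ∀ t x, Torus.nsBodyForce (D.ν m) (D.v2 m) t x =
        D.wF hH m t x + FunctionSpaces.Torus.gradient (D.phiF hH m t) x :=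
  Classical.choose_spec (Classical.choose_spec (hH _ (D.nsBodyForce_v2_smooth m)))

/-- `wF^m` is jointly smooth. [folklore] -/
theorem wF_smooth (m : ℕ) : FunctionSpaces.Torus.IsSmoothSpaceTimeOn univ (D.wF hH m) := (D.wF_spec hH m).1

/-- `phiF^m` is jointly smooth. [folklore] -/
theorem phiF_smooth (m : ℕ) : FunctionSpaces.Torus.IsSmoothSpaceTimeOn univ (D.phiF hH m) := (D.wF_spec hH m).2.1

/-- `wF^m(t)` is divergence free. [folklore] -/
theorem wF_divFree (m : ℕ) (t : ℝ) : FunctionSpaces.Torus.IsDivFree (D.wF hH m t) := (D.wF_spec hH m).2.2.1 t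

/-- The decomposition `body force = wF + ∇phiF`. [folklore] -/
theorem nsBodyForce_v2_eq (m : ℕ) (t : ℝ) (x : 𝕋²) :
    Torus.nsBodyForce (D.ν m) (D.v2 m) t x =
      D.wF hH m t x + FunctionSpaces.Torus.gradient (D.phiF hH m t) x :=
  (D.wF_spec hH m).2.2.2.2 t x

/-- `wF^m(t)` has zero mean (the body force has, and gradients have). [folklore] -/
theorem wF_zeroMean (m : ℕ) (t : ℝ) : FunctionSpaces.Torus.HasZeroMean (D.wF hH m t) := by
  have hw := (D.wF_smooth hH m).isSmooth_slice (mem_univ t)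
  have hφ := (D.phiF_smooth hH m).isSmooth_slice (mem_univ t)
  refine (FunctionSpaces.Torus.hasZeroMean_add_gradient_iff hw hφ).1 ?_
  have h : (fun x => D.wF hH m t x + FunctionSpaces.Torus.gradient (D.phiF hH m t) x) =
      Torus.nsBodyForce (D.ν m) (D.v2 m) t := by
    funext x; exact (D.nsBodyForce_v2_eq hH m t x).symm
  rw [h]
  exact D.nsBodyForce_v2_zeroMean m t

/-- `wF^m` is `1`-periodic (uniqueness of the solenoidal part). [folklore] -/
theorem wF_periodic (m : ℕ) : Periodic (D.wF hH m) 1 :=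
  FunctionSpaces.Torus.periodic_of_helmholtz (D.nsBodyForce_v2_periodic m)
    (fun t => (D.wF_smooth hH m).isSmooth_slice (mem_univ t)) (D.wF_divFree hH m)
    (fun t => (D.phiF_smooth hH m).isSmooth_slice (mem_univ t)) (D.nsBodyForce_v2_eq hH m)

/-! ## The solenoidal part of the limit drift force -/

/-- The solenoidal part `wInf(t)` of the limit force `Ginf(t)` (fixed-time Leray–Helmholtz). [cite: Cheskidov2023, §6 p. 18] -/
def wInf (t : ℝ) : 𝕋² → E² := Classical.choose (hH.smooth_helmholtz _ (D.Ginf_smooth_slice t))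

/-- The mean-zero potential of the gradient part of `Ginf(t)`. [cite: Cheskidov2023, §6 p. 18] -/
def phiInf (t : ℝ) : 𝕋² → ℝ :=
  Classical.choose (Classical.choose_spec (hH.smooth_helmholtz _ (D.Ginf_smooth_slice t)))

/-- The defining properties of `(wInf(t), phiInf(t))`. [folklore] -/
theorem wInf_spec (t : ℝ) :
    FunctionSpaces.Torus.IsSmooth (D.wInf hH t) ∧ FunctionSpaces.Torus.IsSmooth (D.phiInf hH t) ∧
      FunctionSpaces.Torus.IsDivFree (D.wInf hH t) ∧ FunctionSpaces.Torus.HasZeroMean (D.phiInf hH t) ∧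
      ∀ x, D.Ginf t x = D.wInf hH t x + FunctionSpaces.Torus.gradient (D.phiInf hH t) x :=
  Classical.choose_spec (Classical.choose_spec (hH.smooth_helmholtz _ (D.Ginf_smooth_slice t)))

/-- `wInf` is `1`-periodic. [folklore] -/
theorem wInf_periodic : Periodic (D.wInf hH) 1 :=
  FunctionSpaces.Torus.periodic_of_helmholtz D.Ginf_periodic (fun t => (D.wInf_spec hH t).1)
    (fun t => (D.wInf_spec hH t).2.2.1) (fun t => (D.wInf_spec hH t).2.1) (fun t => (D.wInf_spec hH t).2.2.2.2)

/-- **`L²`-contractivity between the two solenoidal parts**: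
`‖wF^m(t) - wInf(t)‖_{L²} ≤ ‖(body force of v₂^m)(t) - Ginf(t)‖_{L²}`. [folklore] -/
theorem eLpNorm_wF_sub_wInf_le (m : ℕ) (t : ℝ) :
    eLpNorm (D.wF hH m t - D.wInf hH t) 2 volume ≤
      eLpNorm (Torus.nsBodyForce (D.ν m) (D.v2 m) t - D.Ginf t) 2 volume :=
  FunctionSpaces.Torus.eLpNorm_sub_le_of_helmholtz ((D.wF_smooth hH m).isSmooth_slice (mem_univ t))
    (D.wInf_spec hH t).1 (D.wF_divFree hH m t) (D.wInf_spec hH t).2.2.1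
    ((D.phiF_smooth hH m).isSmooth_slice (mem_univ t)) (D.wInf_spec hH t).2.1
    (D.nsBodyForce_v2_eq hH m t) (D.wInf_spec hH t).2.2.2.2

/-- **`wInf ∈ C(ℝ; L²)`** (contractivity against `Ginf ∈ C(ℝ; L²)`). [cite: Cheskidov2023, §6 p. 18] -/
theorem wInf_continuousInLpOn : Torus.ContinuousInLpOn univ 2 (D.wInf hH) := by
  refine ⟨fun t _ => (D.wInf_spec hH t).1.memLp 2, fun t₀ _ => ?_⟩
  have h := D.Ginf_continuousInLpOn.2 t₀ (mem_univ t₀)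
  refine tendsto_of_tendsto_of_tendsto_of_le_of_le' tendsto_const_nhds h
    (Eventually.of_forall fun t => zero_le) (Eventually.of_forall fun t => ?_)
  exact FunctionSpaces.Torus.eLpNorm_sub_le_of_helmholtz (D.wInf_spec hH t).1 (D.wInf_spec hH t₀).1
    (D.wInf_spec hH t).2.2.1 (D.wInf_spec hH t₀).2.2.1 (D.wInf_spec hH t).2.1 (D.wInf_spec hH t₀).2.1
    (D.wInf_spec hH t).2.2.2.2 (D.wInf_spec hH t₀).2.2.2.2

/-- **Convergence of the solenoidal parts**: `sup_t ‖wF^m(t) - wInf(t)‖_{L²} → 0`. [cite: Cheskidov2023, §6 p. 18] -/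
theorem tendsto_wF_sub_wInf :
    Tendsto (fun m => ⨆ t : ℝ, eLpNorm (D.wF hH m t - D.wInf hH t) 2 volume) atTop (𝓝 0) :=
  tendsto_of_tendsto_of_tendsto_of_le_of_le' tendsto_const_nhds D.tendsto_nsBodyForce_v2_sub_Ginf
    (Eventually.of_forall fun _ => zero_le)
    (Eventually.of_forall fun m => iSup_mono fun t => D.eLpNorm_wF_sub_wInf_le hH m t)

end Helmholtz

section Assembly

variable (hH : FunctionSpaces.Torus.smooth_leray_helmholtz (Fin 2))

/-! ## The witnesses -/

/-- The velocity `u^{ν_m} = (v₂^m, θ₂^m) ∘ π` on `ℝ × T³` (Cheskidov 2023, §6, p. 18, with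
`a_m = 1`). [cite: Cheskidov2023, §6 p. 18] -/
def us (m : ℕ) (t : ℝ) : 𝕋³ → E³ := twoHalf (D.v2 m t) (D.theta2 m t)

/-- The pressure `p^{ν_m} = -phiF^m ∘ π` (absorbing the gradient part of the drift force). [folklore] -/
def ps (m : ℕ) (t : ℝ) : 𝕋³ → ℝ := (fun y => -D.phiF hH m t y) ∘ planarProj

/-- The force `f^{ν_m}`: the `2½`-dimensional residual force with planar potential `-phiF^m`, i.e.
`(wF^m, h^m) ∘ π` (`fs_eq`). [cite: Cheskidov2023, §6 p. 18] -/
def fs (m : ℕ) : ℝ → 𝕋³ → E³ :=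
  Torus.twoHalfForce univ (D.ν m) (D.v2 m) (D.theta2 m) (fun t y => -D.phiF hH m t y)

/-- The limit force `f = (wInf, Hinf) ∘ π`. [cite: Cheskidov2023, §6 p. 18] -/
def fLim (t : ℝ) : 𝕋³ → E³ := twoHalf (D.wInf hH t) (D.Hinf t)

/-! ## The Navier–Stokes equations and the structure of the force -/

/-- **`(u^{ν_m}, p^{ν_m})` solves the Navier–Stokes system with force `f^{ν_m}` on `ℝ × T³`.** [cite: Cheskidov2023, §6 p. 18] -/
theorem us_isClassicalNSSolutionOn (m : ℕ) :
    FunctionSpaces.Torus.IsClassicalNSSolutionOn univ (D.ν m) (D.fs hH m) (D.us m) (D.ps hH m) :=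
  Torus.isClassicalNSSolutionOn_twoHalf uniqueDiffOn_univ (D.ν m) (D.v2_smooth m) (D.theta2_smooth m)
    (D.phiF_smooth hH m).neg fun t _ => D.v2_divFree m t

/-- **Structure of the force**: `f^{ν_m}(t) = (wF^m(t), h^m(t)) ∘ π` with `h^m` the
advection–diffusion residual of `(v₂^m, θ₂^m)` (the drift part `∂ₜv₂ + (v₂·∇)v₂ - νΔv₂ - ∇phiF`
is the solenoidal part `wF`). [cite: Cheskidov2023, §6 p. 18] -/
theorem fs_eq (m : ℕ) :
    D.fs hH m = fun t => twoHalf (D.wF hH m t) (Torus.adResidual (D.ν m) (D.v2 m) (D.theta2 m) t) := by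
  funext t
  rw [fs, Torus.twoHalfForce]
  congr 1
  funext y
  have hφ1 : FunctionSpaces.Torus.IsContDiff 1 (D.phiF hH m t) :=
    ((D.phiF_smooth hH m).isSmooth_slice (mem_univ t)).isContDiff (by simp)
  rw [Torus.gradient_neg hφ1, ← Torus.nsBodyForce_apply, D.nsBodyForce_v2_eq hH m t y]
  abel

/-- `f^{ν_m}` is jointly smooth. [folklore] -/
theorem fs_smooth (m : ℕ) : FunctionSpaces.Torus.IsSmoothSpaceTimeOn univ (D.fs hH m) := by
  rw [D.fs_eq hH]
  exact (D.wF_smooth hH m).twoHalf (D.adResidual_v2_theta2_smooth m)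

/-- `f^{ν_m}` is `1`-periodic. [folklore] -/
theorem fs_periodic (m : ℕ) : Periodic (D.fs hH m) 1 := by
  rw [D.fs_eq hH]
  exact Torus.periodic_twoHalf (D.wF_periodic hH m) (D.adResidual_v2_theta2_periodic m)

/-- `f^{ν_m}(t)` is divergence free. [folklore] -/
theorem fs_divFree (m : ℕ) (t : ℝ) : FunctionSpaces.Torus.IsDivFree (D.fs hH m t) := by
  rw [D.fs_eq hH]
  exact (D.wF_divFree hH m t).twoHalf _

/-- `f^{ν_m}(t)` has zero mean. [folklore] -/
theorem fs_zeroMean (m : ℕ) (t : ℝ) : FunctionSpaces.Torus.HasZeroMean (D.fs hH m t) := by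
  rw [D.fs_eq hH]
  exact Torus.hasZeroMean_twoHalf ((D.wF_smooth hH m).isSmooth_slice (mem_univ t)).integrable
    ((D.adResidual_v2_theta2_smooth m).isSmooth_slice (mem_univ t)).integrable (D.wF_zeroMean hH m t)
    (D.adResidual_v2_theta2_zeroMean m t)

/-- The limit force is `1`-periodic. [folklore] -/
theorem fLim_periodic : Periodic (D.fLim hH) 1 :=
  Torus.periodic_twoHalf (D.wInf_periodic hH) D.Hinf_periodic

/-- **The limit force is in `C(ℝ; L²(T³))`.** [cite: Cheskidov2023, Thm. 1.3] -/
theorem fLim_continuousInLpOn : Torus.ContinuousInLpOn univ 2 (D.fLim hH) :=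
  Torus.continuousInLpOn_twoHalf (D.wInf_continuousInLpOn hH) D.Hinf_continuousInLpOn

/-- **`f^{ν_m} → f` in `C(ℝ; L²)`**: `sup_t ‖f^{ν_m}(t) - f(t)‖_{L²(T³)} → 0`. [cite: Cheskidov2023, Thm. 1.3] -/
theorem tendsto_fs_sub_fLim :
    Tendsto (fun m => ⨆ t : ℝ, eLpNorm (D.fs hH m t - D.fLim hH t) 2 volume) atTop (𝓝 0) := by
  have h := (D.tendsto_wF_sub_wInf hH).add D.tendsto_adResidual_sub_Hinf
  rw [add_zero] at h
  refine tendsto_of_tendsto_of_tendsto_of_le_of_le' tendsto_const_nhds h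
    (Eventually.of_forall fun _ => zero_le) (Eventually.of_forall fun m => iSup_le fun t => ?_)
  rw [D.fs_eq hH, fLim]
  refine (Torus.eLpNorm_twoHalf_sub_twoHalf_le ?_ ?_ ?_ ?_ one_le_two).trans (add_le_add ?_ ?_)
  · exact ((D.wF_smooth hH m).isSmooth_slice (mem_univ t)).continuous.aestronglyMeasurable
  · exact (D.wInf_spec hH t).1.continuous.aestronglyMeasurable
  · exact ((D.adResidual_v2_theta2_smooth m).isSmooth_slice (mem_univ t)).continuous.aestronglyMeasurable
  · exact D.Hinf_aestronglyMeasurable t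
  · exact le_iSup (fun t => eLpNorm (D.wF hH m t - D.wInf hH t) 2 volume) t
  · exact le_iSup (fun t => eLpNorm (Torus.adResidual (D.ν m) (D.v2 m) (D.theta2 m) t - D.Hinf t) 2 volume) t

/-! ## The velocity: periodicity, mean, energy, dissipation -/

/-- `u^{ν_m}` is `1`-periodic. [folklore] -/
theorem us_periodic (m : ℕ) : Periodic (D.us m) 1 :=
  Torus.periodic_twoHalf (D.v2_periodic m) (D.theta2_periodic m)

/-- `u^{ν_m}(t)` has zero mean. [folklore] -/
theorem us_zeroMean (m : ℕ) (t : ℝ) : FunctionSpaces.Torus.HasZeroMean (D.us m t) :=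
  Torus.hasZeroMean_twoHalf ((D.v2_smooth m).isSmooth_slice (mem_univ t)).integrable
    ((D.theta2_smooth m).isSmooth_slice (mem_univ t)).integrable (D.v2_zeroMean m t) (D.theta2_zeroMean m t)

/-- Pointwise-in-time energy bound `∫ ‖u^{ν_m}(t)‖² ≤ B + 1`. [cite: Cheskidov2023, §6 (6.5)] -/
theorem integral_norm_sq_us_le (m : ℕ) (t : ℝ) : ∫ x, ‖D.us m t x‖ ^ 2 ≤ D.B + 1 := by
  rw [us, Torus.integral_norm_sq_twoHalf ((D.v2_smooth m).isSmooth_slice (mem_univ t)).continuous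
    ((D.theta2_smooth m).isSmooth_slice (mem_univ t)).continuous]
  exact add_le_add (D.v2_sq_le m t) (D.theta2_sq_le m t)

/-- **Mean energy bound**: `⟨‖u^{ν_m}‖²⟩ ≤ B + 1` (long-time average = period average). [cite: Cheskidov2023, §6 p. 18] -/
theorem meanEnergy_us_le (m : ℕ) : meanEnergy (D.us m) ≤ D.B + 1 := by
  rw [meanEnergy_eq_of_periodic (D.us_periodic m) one_pos, inv_one, one_mul]
  have hB := D.B_nonneg
  by_cases hi : IntervalIntegrable (fun t => ∫ x, ‖D.us m t x‖ ^ 2) volume 0 1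
  · calc ∫ t in (0 : ℝ)..1, ∫ x, ‖D.us m t x‖ ^ 2 ≤ ∫ _ in (0 : ℝ)..1, (D.B + 1) :=
          intervalIntegral.integral_mono_on zero_le_one hi intervalIntegrable_const
            fun t _ => D.integral_norm_sq_us_le m t
      _ = D.B + 1 := by simp
  · rw [intervalIntegral.integral_undef hi]
    linarith

/-- The dissipation integrand of `u^{ν_m}` and its scalar lower bound. [folklore] -/
theorem dissipation_integrand_ge (m : ℕ) (t : ℝ) :
    D.ν m * Torus.scalarGradNormSq (D.theta2 m t) ≤ D.ν m * (FunctionSpaces.Torus.eGradNormSq (D.us m t)).toReal :=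
  mul_le_mul_of_nonneg_left (Torus.scalarGradNormSq_le_toReal_eGradNormSq_twoHalf
    ((D.v2_smooth m).isSmooth_slice (mem_univ t)) ((D.theta2_smooth m).isSmooth_slice (mem_univ t)))
    (D.ν_pos m).le

/-- Continuity of the dissipation integrand of `u^{ν_m}`. [folklore] -/
theorem continuous_dissipation_integrand (m : ℕ) :
    Continuous fun t => D.ν m * (FunctionSpaces.Torus.eGradNormSq (D.us m t)).toReal := by
  have h : (fun t => D.ν m * (FunctionSpaces.Torus.eGradNormSq (D.us m t)).toReal) = fun t =>
      D.ν m * (FunctionSpaces.Torus.gradNormSq (D.v2 m t) + Torus.scalarGradNormSq (D.theta2 m t)) := by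
    funext t
    rw [us, Torus.toReal_eGradNormSq_twoHalf ((D.v2_smooth m).isSmooth_slice (mem_univ t))
      ((D.theta2_smooth m).isSmooth_slice (mem_univ t))]
  rw [h]
  refine continuous_const.mul ?_
  have h1 := (D.v2_smooth m).continuousOn_gradNormSq convex_univ uniqueDiffOn_univ
  have h2 := (D.theta2_smooth m).continuousOn_scalarGradNormSq convex_univ uniqueDiffOn_univ
  exact (continuousOn_univ.1 h1).add (continuousOn_univ.1 h2)

/-- Continuity of the scalar dissipation integrand of `θ₂^m`. [folklore] -/
theorem continuous_scalar_integrand (m : ℕ) : Continuous fun t => D.ν m * Torus.scalarGradNormSq (D.theta2 m t) :=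
  continuous_const.mul (continuousOn_univ.1
    ((D.theta2_smooth m).continuousOn_scalarGradNormSq convex_univ uniqueDiffOn_univ))

/-- On `[3/4, 1]` the periodised cut-off density is the original one: `θ₂^m(t) = θ^m(t)`. [folklore] -/
theorem theta2_eq_θ {m : ℕ} {t : ℝ} (ht : t ∈ Icc (3 / 4 : ℝ) 1) : D.theta2 m t = D.θ m t := by
  rw [theta2, Literature.Analysis.FunctionSpaces.timePeriodize_eq_self one_pos _ ⟨by linarith [ht.1], by linarith [ht.2]⟩]
  funext x
  rw [theta1, eta_eq_one ⟨ht.1, by linarith [ht.2]⟩, one_smul]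

/-- **Mean dissipation lower bound**: `⟨ν_m ‖∇u^{ν_m}‖²⟩ ≥ ν_m ∫_{3/4}^{1} ‖∇θ^m(t)‖² dt`
(period average over the window `[2/5, 7/5]`, drop the drift part and the times outside
`[1 - τ/4, 1]`; Cheskidov 2023, p. 19, first display). [cite: Cheskidov2023, §6 p. 19] -/
theorem meanDissipation_us_ge (m : ℕ) :
    D.ν m * ∫ t in (3 / 4 : ℝ)..1, Torus.scalarGradNormSq (D.θ m t) ≤ meanDissipation (D.ν m) (D.us m) := by
  have hper : Periodic (fun t => D.ν m * (FunctionSpaces.Torus.eGradNormSq (D.us m t)).toReal) 1 :=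
    fun t => by simp only [D.us_periodic m t]
  rw [meanDissipation_eq_of_periodic (D.us_periodic m) one_pos, inv_one, one_mul]
  have e : ∫ t in (0 : ℝ)..1, D.ν m * (FunctionSpaces.Torus.eGradNormSq (D.us m t)).toReal =
      ∫ t in (2 / 5 : ℝ)..2 / 5 + 1, D.ν m * (FunctionSpaces.Torus.eGradNormSq (D.us m t)).toReal := by
    have := hper.intervalIntegral_add_eq 0 (2 / 5)
    rwa [zero_add] at this
  rw [e]
  have hG := D.continuous_dissipation_integrand m
  have hL := D.continuous_scalar_integrand m
  calc D.ν m * ∫ t in (3 / 4 : ℝ)..1, Torus.scalarGradNormSq (D.θ m t)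
      = ∫ t in (3 / 4 : ℝ)..1, D.ν m * Torus.scalarGradNormSq (D.theta2 m t) := by
        rw [← intervalIntegral.integral_const_mul]
        refine intervalIntegral.integral_congr fun t ht => ?_
        rw [uIcc_of_le (by norm_num)] at ht
        simp only [D.theta2_eq_θ ht]
    _ ≤ ∫ t in (2 / 5 : ℝ)..2 / 5 + 1, D.ν m * Torus.scalarGradNormSq (D.theta2 m t) :=
        intervalIntegral.integral_mono_interval (by norm_num) (by norm_num) (by norm_num)
          (Eventually.of_forall fun t => mul_nonneg (D.ν_pos m).le (Torus.scalarGradNormSq_nonneg _))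
          (hL.intervalIntegrable _ _)
    _ ≤ ∫ t in (2 / 5 : ℝ)..2 / 5 + 1, D.ν m * (FunctionSpaces.Torus.eGradNormSq (D.us m t)).toReal :=
        intervalIntegral.integral_mono_on (by norm_num) (hL.intervalIntegrable _ _) (hG.intervalIntegrable _ _)
          fun t _ => D.dissipation_integrand_ge m t

/-- **Eventually the mean dissipation is at least `1/4`** (partial dissipation with `s = 3/4`:
`2ν_m ∫_{3/4}^{1} ‖∇θ^m‖² → ε₀ > 1/2`). [cite: Cheskidov2023, (6.4) and §6 p. 19] -/
theorem eventually_meanDissipation_ge : ∀ᶠ m in atTop, (4 : ℝ)⁻¹ ≤ meanDissipation (D.ν m) (D.us m) := by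
  have h := D.θ_dissipation (3 / 4) ⟨by norm_num, by norm_num⟩
  have h2 : ∀ᶠ m in atTop, (2 : ℝ)⁻¹ < 2 * D.ν m * ∫ t in (3 / 4 : ℝ)..1, Torus.scalarGradNormSq (D.θ m t) :=
    h.eventually (lt_mem_nhds D.half_lt_ε₀)
  filter_upwards [h2] with m hm
  have h3 := D.meanDissipation_us_ge m
  nlinarith

/-! ## Assembly -/

/-- **Theorem 1.3 of Cheskidov 2023 from partial-dissipation family data and the smooth
Leray–Helmholtz decomposition** (solenoidal normalisation, `ℓ = 1`; the sequence is re-indexed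
from the index where the mean dissipation exceeds `1/4`). [cite: Cheskidov2023, Thm. 1.3 and §6] -/
theorem cheskidov_time_periodic_anomaly (D : PartialFamilyData)
    (hH : FunctionSpaces.Torus.smooth_leray_helmholtz (Fin 2)) :
    Literature.Analysis.FluidPDE.cheskidov_time_periodic_anomaly := by
  obtain ⟨m₀, hm₀⟩ := eventually_atTop.1 D.eventually_meanDissipation_ge
  refine ⟨1, D.fLim hH, fun k => D.ν (m₀ + k), fun k => D.fs hH (m₀ + k), fun k => D.us (m₀ + k),
    fun k => D.ps hH (m₀ + k), one_pos, D.fLim_periodic hH, D.fLim_continuousInLpOn hH,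
    fun k => D.ν_pos _, ?_, fun k => ⟨D.fs_smooth hH _, D.fs_periodic hH _, fun t =>
      ⟨D.fs_divFree hH _ t, D.fs_zeroMean hH _ t⟩⟩, ?_,
    fun k => ⟨D.us_isClassicalNSSolutionOn hH _, D.us_periodic _, fun t => D.us_zeroMean _ t⟩,
    ⟨D.B + 1, fun k => D.meanEnergy_us_le _⟩, ⟨4⁻¹, by norm_num, fun k => hm₀ _ (Nat.le_add_right _ _)⟩, ?_⟩
  · -- `ν_{m₀+k} → 0`
    exact D.ν_tendsto.comp (tendsto_atTop_atTop_of_monotone (fun a b h => Nat.add_le_add_left h _)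
      fun n => ⟨n, Nat.le_add_left _ _⟩)
  · -- force convergence along the shifted sequence
    exact (D.tendsto_fs_sub_fLim hH).comp (tendsto_atTop_atTop_of_monotone
      (fun a b h => Nat.add_le_add_left h _) fun n => ⟨n, Nat.le_add_left _ _⟩)
  · -- the Doering–Foias reading: `c U³ ≤ ε` with `c = (1/4) / (B+1)^{3/2}`
    have hE : 0 < D.B + 1 := by linarith [D.B_nonneg]
    refine ⟨4⁻¹ / Real.sqrt (D.B + 1) ^ 3, by positivity, fun k => ?_⟩
    have hU : rmsVelocity longTimeAvgSup (D.us (m₀ + k)) ≤ Real.sqrt (D.B + 1) := by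
      rw [rmsVelocity_eq_sqrt_meanEnergy]
      exact Real.sqrt_le_sqrt (D.meanEnergy_us_le _)
    have hU0 : 0 ≤ rmsVelocity longTimeAvgSup (D.us (m₀ + k)) := by
      rw [rmsVelocity_eq_sqrt_meanEnergy]; exact Real.sqrt_nonneg _
    have hs : 0 < Real.sqrt (D.B + 1) := Real.sqrt_pos.2 hE
    calc 4⁻¹ / Real.sqrt (D.B + 1) ^ 3 * rmsVelocity longTimeAvgSup (D.us (m₀ + k)) ^ 3
        ≤ 4⁻¹ / Real.sqrt (D.B + 1) ^ 3 * Real.sqrt (D.B + 1) ^ 3 := by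
          gcongr
      _ = 4⁻¹ := by field_simp
      _ ≤ meanDissipation (D.ν (m₀ + k)) (D.us (m₀ + k)) := hm₀ _ (Nat.le_add_right _ _)

end Assembly

end PartialFamilyData

/-- **turb.S12 from a partial-dissipation family.** Cheskidov's time-periodic dissipation
anomaly (`cheskidov_time_periodic_anomaly`, arXiv:2311.04182 Thm. 1.3, solenoidal normalisation,
`ℓ = 1`) follows from any partial-dissipation family (`CheskidovPeriodic.PartialFamilyData`),
the smooth Leray–Helmholtz decomposition on `T²` being the discharged
`Torus.smooth_leray_helmholtz_holds`. [cite: Cheskidov2023, Thm. 1.3 and §6] -/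
theorem cheskidov_time_periodic_anomaly_of_partialFamilyData (D : CheskidovPeriodic.PartialFamilyData) :
    cheskidov_time_periodic_anomaly :=
  D.cheskidov_time_periodic_anomaly (FunctionSpaces.Torus.smooth_leray_helmholtz_holds (Fin 2))

end CheskidovPeriodic

end Literature.Analysis.FluidPDE

end
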